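import Summits.CriticalPhenomena.PercolationContinuityZ3.Theorems.Transplant.FKRayleighK4Masses
import Summits.CriticalPhenomena.PercolationContinuityZ3.Theorems.Transplant.FKConnectivityAllQLoops
import Summits.CriticalPhenomena.PercolationContinuityZ3.Theorems.Transplant.FKConnectivityAllQEdgeNegCorr
import Summits.CriticalPhenomena.PercolationContinuityZ3.Theorems.Transplant.FKConnectivityAllQWagner
import Literature.Probability.LatticeModels.RandomClusterEdgeWeightsRelabel
import HarnessLib

/-!
# `K₄` is Potts–Rayleigh for `0 < q ≤ 1` — file 3: the two normal forms on `Fin 4` (pinned states as `RCEval` parameter vectors, bracket sign)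

Support file (`--supports stmt-CriticalPhenomena-4575`), FK sub-lane `prim-bschramm-fk-3` (gen 6) of the post-continuity
programme; builds on p205010 (kernel theorem, internal audit signed; external expert review pending).  No definitions, no named
facts, no sorries; standard axioms.

Towards `FK.edgeNegCorrOn_fin_four` ("`K₄` is Potts–Rayleigh", Wagner 2008 Example 5.2, a computation credited to Sokal;
file 4 `…FKRayleighK4.lean`).  This file: the two NORMAL FORMS on `Fin 4` for a loop-free weight vector `w` and `0 < q ≤ 1`:
`nc_norm_d : φ(J_{01} ∩ J_{23}) ≤ φ(J_{01})·φ(J_{23})` (disjoint pairs) and `nc_norm_a : φ(J_{01} ∩ J_{02}) ≤ φ(J_{01})·φ(J_{02})`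
(adjacent pairs).  Steps: (1) the pinned states `w[01↦0][f↦t]` ARE the parameter vectors `cr5 …` of the shapes `dShape`/`aShape`
(`d_update_eq_wR`, `a_update_eq_wR`; sixteen pairs of `Fin 4` checked one by one); (2) hence their masses / partition functions are the
explicit polynomials of `…FKRayleighK4Masses.lean` (`d_mass_eq`, `a_mass_eq` via `RCEval.sum_rcWeightW_mul_R`); (3) the master identity
`FK.negCorr_defect_eq` (`…AllQEdgeToggle.lean`) reduces negative correlation to `S₀₀·Z₀₁ − S₀₁·Z₀₀ ≥ 0` (`nc_of_bracket`; the identity's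
`Function.update`s carry the classical `DecidableEq` instance of the generic file — bridged by `convert`, `DecidableEq` being a
subsingleton); (4) the certificates `bracketDisj_nonneg` / `bracketAdj_nonneg` of `…FKRayleighK4Cert.lean`.
[cite: Wagner2006, Ex. 5.2, Thm. 5.8] [cite: Grimmett2006, §3.9 eq. (3.94) (p. 63); §1.4 eq. (1.20) (p. 15); §4.3]
-/

noncomputable section

namespace Summit.CriticalPhenomena.PercolationContinuityZ3.Theorems

namespace FK

open MeasureTheory Set Literature.Probability.LatticeModels Literature.Probability.Percolation
open Literature.Probability.Percolation.DecisionTree (ind ind_of_mem ind_of_not_mem ind_nonneg)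
open RayleighK4
open scoped Classical


/-! ### Identification of the pinned weight vectors with the two shapes -/

/-- The pairs `01` and the loops are not listed in `dShape`. [folklore] -/
theorem dShape_notMem_range {e : Sym2 (Fin 4)} (h : e = s(0, 1) ∨ e.IsDiag) : e ∉ Set.range dShape.edge := by
  rintro ⟨k, hk⟩
  rcases h with rfl | h
  · revert hk; fin_cases k <;> decide
  · rw [← hk] at h; revert h; fin_cases k <;> decide

/-- The pairs `01` and the loops are not listed in `aShape`. [folklore] -/
theorem aShape_notMem_range {e : Sym2 (Fin 4)} (h : e = s(0, 1) ∨ e.IsDiag) : e ∉ Set.range aShape.edge := by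
  rintro ⟨k, hk⟩
  rcases h with rfl | h
  · revert hk; fin_cases k <;> decide
  · rw [← hk] at h; revert h; fin_cases k <;> decide

/-- The parameters of `dShape.wR cr` on the listed pairs. [folklore] -/
theorem d_wR_vals {cr : Fin 5 → ℝ} (hc : ∀ i, 0 ≤ cr i ∧ cr i ≤ 1) :
    (dShape.wR cr s((0 : Fin 4), 2) : ℝ) = cr 0 ∧
    (dShape.wR cr s((0 : Fin 4), 3) : ℝ) = cr 1 ∧
    (dShape.wR cr s((1 : Fin 4), 2) : ℝ) = cr 2 ∧
    (dShape.wR cr s((1 : Fin 4), 3) : ℝ) = cr 3 ∧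
    (dShape.wR cr s((2 : Fin 4), 3) : ℝ) = cr 4 := by
  exact ⟨by rw [← dShape_edge_0, RCEval.wR_edge dShape_valid hc], by rw [← dShape_edge_1, RCEval.wR_edge dShape_valid hc], by rw [← dShape_edge_2, RCEval.wR_edge dShape_valid hc], by rw [← dShape_edge_3, RCEval.wR_edge dShape_valid hc], by rw [← dShape_edge_4, RCEval.wR_edge dShape_valid hc]⟩

/-- `dShape.wR cr` vanishes on `01` and on the loops. [folklore] -/
theorem d_wR_zero (cr : Fin 5 → ℝ) {e : Sym2 (Fin 4)} (h : e = s(0, 1) ∨ e.IsDiag) : (dShape.wR cr e : ℝ) = 0 :=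
  RCEval.wR_eq_zero_of_notMem_range cr (dShape_notMem_range h)

/-- **Disjoint normal form, state vector**: a loop-free `w` pinned to `0` at `01` and to `t` at `23` is the parameter
vector of `dShape` with entries `w` on the four free pairs and `t`. [folklore] -/
theorem d_update_eq_wR (w : Sym2 (Fin 4) → unitInterval) (hw : ∀ x : Fin 4, (w s(x, x) : ℝ) = 0) (t : unitInterval) :
    Function.update (Function.update w s(0, 1) 0) s(2, 3) t =
      dShape.wR (cr5 (w s(0, 2)) (w s(0, 3)) (w s(1, 2)) (w s(1, 3)) t) := by
  have hc := cr5_mem (w s(0, 2)).2 (w s(0, 3)).2 (w s(1, 2)).2 (w s(1, 3)).2 t.2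
  obtain ⟨c0, c1, c2, c3, c4⟩ := cr5_vals (w s(0, 2) : ℝ) (w s(0, 3)) (w s(1, 2)) (w s(1, 3)) t
  obtain ⟨v0, v1, v2, v3, v4⟩ := d_wR_vals hc
  funext e
  apply Subtype.ext
  induction e using Sym2.ind with
  | h i j =>
    rcases (show ∀ i : Fin 4, i = 0 ∨ i = 1 ∨ i = 2 ∨ i = 3 by decide) i with rfl | rfl | rfl | rfl <;>
      rcases (show ∀ j : Fin 4, j = 0 ∨ j = 1 ∨ j = 2 ∨ j = 3 by decide) j with rfl | rfl | rfl | rfl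
    · rw [Function.update_of_ne (show s((0 : Fin 4),
          (0 : Fin 4)) ≠ s(2, 3) by decide),
          Function.update_of_ne (show s((0 : Fin 4),
          (0 : Fin 4)) ≠ s(0, 1) by decide), d_wR_zero _ (Or.inr (by decide))]; exact hw 0
    · rw [Function.update_of_ne (show s((0 : Fin 4),
          (1 : Fin 4)) ≠ s(2, 3) by decide),
          Function.update_self,
          d_wR_zero _ (Or.inl rfl)]; rfl
    · rw [Function.update_of_ne (show s((0 : Fin 4),
          (2 : Fin 4)) ≠ s(2, 3) by decide),
          Function.update_of_ne (show s((0 : Fin 4),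
          (2 : Fin 4)) ≠ s(0, 1) by decide), v0, c0]
    · rw [Function.update_of_ne (show s((0 : Fin 4),
          (3 : Fin 4)) ≠ s(2, 3) by decide),
          Function.update_of_ne (show s((0 : Fin 4),
          (3 : Fin 4)) ≠ s(0, 1) by decide), v1, c1]
    · rw [show s((1 : Fin 4), (0 : Fin 4)) = s((0 : Fin 4),
          (1 : Fin 4)) from Sym2.eq_swap]; rw [Function.update_of_ne (show s((0 : Fin 4),
          (1 : Fin 4)) ≠ s(2, 3) by decide),
          Function.update_self,
          d_wR_zero _ (Or.inl rfl)]; rfl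
    · rw [Function.update_of_ne (show s((1 : Fin 4),
          (1 : Fin 4)) ≠ s(2, 3) by decide),
          Function.update_of_ne (show s((1 : Fin 4),
          (1 : Fin 4)) ≠ s(0, 1) by decide), d_wR_zero _ (Or.inr (by decide))]; exact hw 1
    · rw [Function.update_of_ne (show s((1 : Fin 4),
          (2 : Fin 4)) ≠ s(2, 3) by decide),
          Function.update_of_ne (show s((1 : Fin 4),
          (2 : Fin 4)) ≠ s(0, 1) by decide), v2, c2]
    · rw [Function.update_of_ne (show s((1 : Fin 4),
          (3 : Fin 4)) ≠ s(2, 3) by decide),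
          Function.update_of_ne (show s((1 : Fin 4),
          (3 : Fin 4)) ≠ s(0, 1) by decide), v3, c3]
    · rw [show s((2 : Fin 4), (0 : Fin 4)) = s((0 : Fin 4),
          (2 : Fin 4)) from Sym2.eq_swap]; rw [Function.update_of_ne (show s((0 : Fin 4),
          (2 : Fin 4)) ≠ s(2, 3) by decide),
          Function.update_of_ne (show s((0 : Fin 4),
          (2 : Fin 4)) ≠ s(0, 1) by decide), v0, c0]
    · rw [show s((2 : Fin 4), (1 : Fin 4)) = s((1 : Fin 4),
          (2 : Fin 4)) from Sym2.eq_swap]; rw [Function.update_of_ne (show s((1 : Fin 4),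
          (2 : Fin 4)) ≠ s(2, 3) by decide),
          Function.update_of_ne (show s((1 : Fin 4),
          (2 : Fin 4)) ≠ s(0, 1) by decide), v2, c2]
    · rw [Function.update_of_ne (show s((2 : Fin 4),
          (2 : Fin 4)) ≠ s(2, 3) by decide),
          Function.update_of_ne (show s((2 : Fin 4),
          (2 : Fin 4)) ≠ s(0, 1) by decide), d_wR_zero _ (Or.inr (by decide))]; exact hw 2
    · rw [Function.update_self,
          v4, c4]
    · rw [show s((3 : Fin 4), (0 : Fin 4)) = s((0 : Fin 4),
          (3 : Fin 4)) from Sym2.eq_swap]; rw [Function.update_of_ne (show s((0 : Fin 4),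
          (3 : Fin 4)) ≠ s(2, 3) by decide),
          Function.update_of_ne (show s((0 : Fin 4),
          (3 : Fin 4)) ≠ s(0, 1) by decide), v1, c1]
    · rw [show s((3 : Fin 4), (1 : Fin 4)) = s((1 : Fin 4),
          (3 : Fin 4)) from Sym2.eq_swap]; rw [Function.update_of_ne (show s((1 : Fin 4),
          (3 : Fin 4)) ≠ s(2, 3) by decide),
          Function.update_of_ne (show s((1 : Fin 4),
          (3 : Fin 4)) ≠ s(0, 1) by decide), v3, c3]
    · rw [show s((3 : Fin 4), (2 : Fin 4)) = s((2 : Fin 4),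
          (3 : Fin 4)) from Sym2.eq_swap]; rw [Function.update_self,
          v4, c4]
    · rw [Function.update_of_ne (show s((3 : Fin 4),
          (3 : Fin 4)) ≠ s(2, 3) by decide),
          Function.update_of_ne (show s((3 : Fin 4),
          (3 : Fin 4)) ≠ s(0, 1) by decide), d_wR_zero _ (Or.inr (by decide))]; exact hw 3

/-- The parameters of `aShape.wR cr` on the listed pairs. [folklore] -/
theorem a_wR_vals {cr : Fin 5 → ℝ} (hc : ∀ i, 0 ≤ cr i ∧ cr i ≤ 1) :
    (aShape.wR cr s((0 : Fin 4), 3) : ℝ) = cr 0 ∧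
    (aShape.wR cr s((1 : Fin 4), 2) : ℝ) = cr 1 ∧
    (aShape.wR cr s((1 : Fin 4), 3) : ℝ) = cr 2 ∧
    (aShape.wR cr s((2 : Fin 4), 3) : ℝ) = cr 3 ∧
    (aShape.wR cr s((0 : Fin 4), 2) : ℝ) = cr 4 := by
  exact ⟨by rw [← aShape_edge_0, RCEval.wR_edge aShape_valid hc], by rw [← aShape_edge_1, RCEval.wR_edge aShape_valid hc], by rw [← aShape_edge_2, RCEval.wR_edge aShape_valid hc], by rw [← aShape_edge_3, RCEval.wR_edge aShape_valid hc], by rw [← aShape_edge_4, RCEval.wR_edge aShape_valid hc]⟩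

/-- `aShape.wR cr` vanishes on `01` and on the loops. [folklore] -/
theorem a_wR_zero (cr : Fin 5 → ℝ) {e : Sym2 (Fin 4)} (h : e = s(0, 1) ∨ e.IsDiag) : (aShape.wR cr e : ℝ) = 0 :=
  RCEval.wR_eq_zero_of_notMem_range cr (aShape_notMem_range h)

/-- **Adjacent normal form, state vector**: a loop-free `w` pinned to `0` at `01` and to `t` at `02` is the parameter
vector of `aShape` with entries `w` on the four free pairs and `t`. [folklore] -/
theorem a_update_eq_wR (w : Sym2 (Fin 4) → unitInterval) (hw : ∀ x : Fin 4, (w s(x, x) : ℝ) = 0) (t : unitInterval) :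
    Function.update (Function.update w s(0, 1) 0) s(0, 2) t =
      aShape.wR (cr5 (w s(0, 3)) (w s(1, 2)) (w s(1, 3)) (w s(2, 3)) t) := by
  have hc := cr5_mem (w s(0, 3)).2 (w s(1, 2)).2 (w s(1, 3)).2 (w s(2, 3)).2 t.2
  obtain ⟨c0, c1, c2, c3, c4⟩ := cr5_vals (w s(0, 3) : ℝ) (w s(1, 2)) (w s(1, 3)) (w s(2, 3)) t
  obtain ⟨v0, v1, v2, v3, v4⟩ := a_wR_vals hc
  funext e
  apply Subtype.ext
  induction e using Sym2.ind with
  | h i j =>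
    rcases (show ∀ i : Fin 4, i = 0 ∨ i = 1 ∨ i = 2 ∨ i = 3 by decide) i with rfl | rfl | rfl | rfl <;>
      rcases (show ∀ j : Fin 4, j = 0 ∨ j = 1 ∨ j = 2 ∨ j = 3 by decide) j with rfl | rfl | rfl | rfl
    · rw [Function.update_of_ne (show s((0 : Fin 4),
          (0 : Fin 4)) ≠ s(0, 2) by decide),
          Function.update_of_ne (show s((0 : Fin 4),
          (0 : Fin 4)) ≠ s(0, 1) by decide), a_wR_zero _ (Or.inr (by decide))]; exact hw 0
    · rw [Function.update_of_ne (show s((0 : Fin 4),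
          (1 : Fin 4)) ≠ s(0, 2) by decide),
          Function.update_self,
          a_wR_zero _ (Or.inl rfl)]; rfl
    · rw [Function.update_self,
          v4, c4]
    · rw [Function.update_of_ne (show s((0 : Fin 4),
          (3 : Fin 4)) ≠ s(0, 2) by decide),
          Function.update_of_ne (show s((0 : Fin 4),
          (3 : Fin 4)) ≠ s(0, 1) by decide), v0, c0]
    · rw [show s((1 : Fin 4), (0 : Fin 4)) = s((0 : Fin 4),
          (1 : Fin 4)) from Sym2.eq_swap]; rw [Function.update_of_ne (show s((0 : Fin 4),
          (1 : Fin 4)) ≠ s(0, 2) by decide),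
          Function.update_self,
          a_wR_zero _ (Or.inl rfl)]; rfl
    · rw [Function.update_of_ne (show s((1 : Fin 4),
          (1 : Fin 4)) ≠ s(0, 2) by decide),
          Function.update_of_ne (show s((1 : Fin 4),
          (1 : Fin 4)) ≠ s(0, 1) by decide), a_wR_zero _ (Or.inr (by decide))]; exact hw 1
    · rw [Function.update_of_ne (show s((1 : Fin 4),
          (2 : Fin 4)) ≠ s(0, 2) by decide),
          Function.update_of_ne (show s((1 : Fin 4),
          (2 : Fin 4)) ≠ s(0, 1) by decide), v1, c1]
    · rw [Function.update_of_ne (show s((1 : Fin 4),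
          (3 : Fin 4)) ≠ s(0, 2) by decide),
          Function.update_of_ne (show s((1 : Fin 4),
          (3 : Fin 4)) ≠ s(0, 1) by decide), v2, c2]
    · rw [show s((2 : Fin 4), (0 : Fin 4)) = s((0 : Fin 4),
          (2 : Fin 4)) from Sym2.eq_swap]; rw [Function.update_self,
          v4, c4]
    · rw [show s((2 : Fin 4), (1 : Fin 4)) = s((1 : Fin 4),
          (2 : Fin 4)) from Sym2.eq_swap]; rw [Function.update_of_ne (show s((1 : Fin 4),
          (2 : Fin 4)) ≠ s(0, 2) by decide),
          Function.update_of_ne (show s((1 : Fin 4),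
          (2 : Fin 4)) ≠ s(0, 1) by decide), v1, c1]
    · rw [Function.update_of_ne (show s((2 : Fin 4),
          (2 : Fin 4)) ≠ s(0, 2) by decide),
          Function.update_of_ne (show s((2 : Fin 4),
          (2 : Fin 4)) ≠ s(0, 1) by decide), a_wR_zero _ (Or.inr (by decide))]; exact hw 2
    · rw [Function.update_of_ne (show s((2 : Fin 4),
          (3 : Fin 4)) ≠ s(0, 2) by decide),
          Function.update_of_ne (show s((2 : Fin 4),
          (3 : Fin 4)) ≠ s(0, 1) by decide), v3, c3]
    · rw [show s((3 : Fin 4), (0 : Fin 4)) = s((0 : Fin 4),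
          (3 : Fin 4)) from Sym2.eq_swap]; rw [Function.update_of_ne (show s((0 : Fin 4),
          (3 : Fin 4)) ≠ s(0, 2) by decide),
          Function.update_of_ne (show s((0 : Fin 4),
          (3 : Fin 4)) ≠ s(0, 1) by decide), v0, c0]
    · rw [show s((3 : Fin 4), (1 : Fin 4)) = s((1 : Fin 4),
          (3 : Fin 4)) from Sym2.eq_swap]; rw [Function.update_of_ne (show s((1 : Fin 4),
          (3 : Fin 4)) ≠ s(0, 2) by decide),
          Function.update_of_ne (show s((1 : Fin 4),
          (3 : Fin 4)) ≠ s(0, 1) by decide), v2, c2]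
    · rw [show s((3 : Fin 4), (2 : Fin 4)) = s((2 : Fin 4),
          (3 : Fin 4)) from Sym2.eq_swap]; rw [Function.update_of_ne (show s((2 : Fin 4),
          (3 : Fin 4)) ≠ s(0, 2) by decide),
          Function.update_of_ne (show s((2 : Fin 4),
          (3 : Fin 4)) ≠ s(0, 1) by decide), v3, c3]
    · rw [Function.update_of_ne (show s((3 : Fin 4),
          (3 : Fin 4)) ≠ s(0, 2) by decide),
          Function.update_of_ne (show s((3 : Fin 4),
          (3 : Fin 4)) ≠ s(0, 1) by decide), a_wR_zero _ (Or.inr (by decide))]; exact hw 3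


/-! ### The two normal forms: negative correlation of `J_{01}` with `J_{23}` and with `J_{02}` -/

/-- Mass of an event under a pinned state, as an `RCEval` sum (disjoint shape). [folklore] -/
theorem d_mass_eq (w : Sym2 (Fin 4) → unitInterval) (hw : ∀ x : Fin 4, (w s(x, x) : ℝ) = 0) {q : ℝ} {t : unitInterval}
    {tr : ℝ} (htr : (t : ℝ) = tr) (htr' : 0 ≤ tr ∧ tr ≤ 1) (F : BondConfig (Fin 4) → ℝ) :
    ∑ ω : BondConfig (Fin 4), rcWeightW (Function.update (Function.update w s(0, 1) 0) s(2, 3) t) q ∅ ω * F ω =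
      ∑ s : Finset (Fin 5), dShape.mR (cr5 (w s(0, 2)) (w s(0, 3)) (w s(1, 2)) (w s(1, 3)) tr) q s * F (dShape.conf s) := by
  rw [d_update_eq_wR w hw t, htr]
  exact RCEval.sum_rcWeightW_mul_R dShape_valid
    (cr5_mem (w s(0, 2)).2 (w s(0, 3)).2 (w s(1, 2)).2 (w s(1, 3)).2 htr') q F

/-- Mass of an event under a pinned state, as an `RCEval` sum (adjacent shape). [folklore] -/
theorem a_mass_eq (w : Sym2 (Fin 4) → unitInterval) (hw : ∀ x : Fin 4, (w s(x, x) : ℝ) = 0) {q : ℝ} {t : unitInterval}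
    {tr : ℝ} (htr : (t : ℝ) = tr) (htr' : 0 ≤ tr ∧ tr ≤ 1) (F : BondConfig (Fin 4) → ℝ) :
    ∑ ω : BondConfig (Fin 4), rcWeightW (Function.update (Function.update w s(0, 1) 0) s(0, 2) t) q ∅ ω * F ω =
      ∑ s : Finset (Fin 5), aShape.mR (cr5 (w s(0, 3)) (w s(1, 2)) (w s(1, 3)) (w s(2, 3)) tr) q s * F (aShape.conf s) := by
  rw [a_update_eq_wR w hw t, htr]
  exact RCEval.sum_rcWeightW_mul_R aShape_valid
    (cr5_mem (w s(0, 3)).2 (w s(1, 2)).2 (w s(1, 3)).2 (w s(2, 3)).2 htr') q F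

/-- The partition function as a sum with the constant function `1`. [folklore] -/
theorem rcPartitionFunctionW_eq_sum_mul_one (w : Sym2 (Fin 4) → unitInterval) (q : ℝ) :
    rcPartitionFunctionW w q ∅ = ∑ ω : BondConfig (Fin 4), rcWeightW w q ∅ ω * (fun _ => (1 : ℝ)) ω := by
  unfold rcPartitionFunctionW; simp only [mul_one]

/-- From the master identity and a nonpositive bracket to negative correlation. [folklore] -/
theorem nc_of_bracket (w : Sym2 (Fin 4) → unitInterval) {q : ℝ} (hq0 : 0 < q) (hq1 : q ≤ 1) (f : Sym2 (Fin 4))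
    (hfe : f ≠ s(0, 1))
    (hbr : (∑ ω : BondConfig (Fin 4), rcWeightW (Function.update (Function.update w s(0, 1) 0) f 1) q ∅ ω *
              ind (openConn (0 : Fin 4) 1 : Set (BondConfig (Fin 4)))ᶜ ω) *
            rcPartitionFunctionW (Function.update (Function.update w s(0, 1) 0) f 0) q ∅ -
          (∑ ω : BondConfig (Fin 4), rcWeightW (Function.update (Function.update w s(0, 1) 0) f 0) q ∅ ω *
              ind (openConn (0 : Fin 4) 1 : Set (BondConfig (Fin 4)))ᶜ ω) *
            rcPartitionFunctionW (Function.update (Function.update w s(0, 1) 0) f 1) q ∅ ≤ 0) :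
    (rcMeasureW w q ∅).real ({ω | s((0 : Fin 4), 1) ∈ ω} ∩ {ω | f ∈ ω}) ≤
      (rcMeasureW w q ∅).real {ω | s((0 : Fin 4), 1) ∈ ω} * (rcMeasureW w q ∅).real {ω | f ∈ ω} := by
  have hZ := rcPartitionFunctionW_pos w hq0 (∅ : Set (Fin 4))
  rw [rcMeasureW_real_eq_sum_div w hq0 ∅, rcMeasureW_real_eq_sum_div w hq0 ∅, rcMeasureW_real_eq_sum_div w hq0 ∅,
    div_mul_div_comm, div_le_div_iff₀ hZ (mul_pos hZ hZ)]
  -- the master identity (its `Function.update`s carry the classical `DecidableEq` instance of the generic file; `convert`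
  -- identifies them with this file's instances, `DecidableEq` being a subsingleton)
  have hm : (∑ ω : BondConfig (Fin 4), rcWeightW w q ∅ ω * ind ({ω | s((0 : Fin 4), 1) ∈ ω} ∩ {ω | f ∈ ω}) ω) *
        rcPartitionFunctionW w q ∅ -
      (∑ ω : BondConfig (Fin 4), rcWeightW w q ∅ ω * ind {ω | s((0 : Fin 4), 1) ∈ ω} ω) *
        (∑ ω : BondConfig (Fin 4), rcWeightW w q ∅ ω * ind {ω | f ∈ ω} ω) =
      (w s((0 : Fin 4), 1) : ℝ) * (1 - (w s((0 : Fin 4), 1) : ℝ)) * ((w f : ℝ) * (1 - (w f : ℝ))) * (q⁻¹ - 1) *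
        ((∑ ω : BondConfig (Fin 4), rcWeightW (Function.update (Function.update w s(0, 1) 0) f 1) q ∅ ω *
              ind (openConn (0 : Fin 4) 1 : Set (BondConfig (Fin 4)))ᶜ ω) *
            rcPartitionFunctionW (Function.update (Function.update w s(0, 1) 0) f 0) q ∅ -
          (∑ ω : BondConfig (Fin 4), rcWeightW (Function.update (Function.update w s(0, 1) 0) f 0) q ∅ ω *
              ind (openConn (0 : Fin 4) 1 : Set (BondConfig (Fin 4)))ᶜ ω) *
            rcPartitionFunctionW (Function.update (Function.update w s(0, 1) 0) f 1) q ∅) :=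
    by convert negCorr_defect_eq w hq0.ne' (0 : Fin 4) 1 hfe
  have hc0 : 0 ≤ (w s((0 : Fin 4), 1) : ℝ) := (w _).2.1
  have hc1 : (w s((0 : Fin 4), 1) : ℝ) ≤ 1 := (w _).2.2
  have hd0 : 0 ≤ (w f : ℝ) := (w _).2.1
  have hd1 : (w f : ℝ) ≤ 1 := (w _).2.2
  have hq' : 0 ≤ q⁻¹ - 1 := by rw [sub_nonneg]; exact one_le_inv_iff₀.2 ⟨hq0, hq1⟩
  have hpre : 0 ≤ (w s((0 : Fin 4), 1) : ℝ) * (1 - (w s((0 : Fin 4), 1) : ℝ)) * ((w f : ℝ) * (1 - (w f : ℝ))) * (q⁻¹ - 1) :=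
    mul_nonneg (mul_nonneg (mul_nonneg hc0 (by linarith)) (mul_nonneg hd0 (by linarith))) hq'
  have h1 := mul_nonpos_iff.2 (Or.inl ⟨hpre, hbr⟩)
  have h2 : (∑ ω : BondConfig (Fin 4), rcWeightW w q ∅ ω * ind ({ω | s((0 : Fin 4), 1) ∈ ω} ∩ {ω | f ∈ ω}) ω) *
      rcPartitionFunctionW w q ∅ ≤
      (∑ ω : BondConfig (Fin 4), rcWeightW w q ∅ ω * ind {ω | s((0 : Fin 4), 1) ∈ ω} ω) *
        (∑ ω : BondConfig (Fin 4), rcWeightW w q ∅ ω * ind {ω | f ∈ ω} ω) := by linarith [hm, h1]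
  calc (∑ ω : BondConfig (Fin 4), rcWeightW w q ∅ ω * ind ({ω | s((0 : Fin 4), 1) ∈ ω} ∩ {ω | f ∈ ω}) ω) *
        (rcPartitionFunctionW w q ∅ * rcPartitionFunctionW w q ∅)
      = (∑ ω : BondConfig (Fin 4), rcWeightW w q ∅ ω * ind ({ω | s((0 : Fin 4), 1) ∈ ω} ∩ {ω | f ∈ ω}) ω) *
        rcPartitionFunctionW w q ∅ * rcPartitionFunctionW w q ∅ := by ring
    _ ≤ (∑ ω : BondConfig (Fin 4), rcWeightW w q ∅ ω * ind {ω | s((0 : Fin 4), 1) ∈ ω} ω) *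
        (∑ ω : BondConfig (Fin 4), rcWeightW w q ∅ ω * ind {ω | f ∈ ω} ω) * rcPartitionFunctionW w q ∅ :=
        mul_le_mul_of_nonneg_right h2 hZ.le

/-- **`K₄` is Potts–Rayleigh, disjoint pairs**: for a loop-free weight vector on `Fin 4` and `0 < q ≤ 1`,
`φ(J_{01} ∩ J_{23}) ≤ φ(J_{01})·φ(J_{23})`. [cite: Wagner2006, Ex. 5.2] [cite: Grimmett2006, §3.9 eq. (3.94) (p. 63)] -/
theorem nc_norm_d (w : Sym2 (Fin 4) → unitInterval) (hw : ∀ x : Fin 4, (w s(x, x) : ℝ) = 0) {q : ℝ} (hq0 : 0 < q)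
    (hq1 : q ≤ 1) :
    (rcMeasureW w q ∅).real ({ω | s((0 : Fin 4), 1) ∈ ω} ∩ {ω | s((2 : Fin 4), 3) ∈ ω}) ≤
      (rcMeasureW w q ∅).real {ω | s((0 : Fin 4), 1) ∈ ω} * (rcMeasureW w q ∅).real {ω | s((2 : Fin 4), 3) ∈ ω} := by
  refine nc_of_bracket w hq0 hq1 _ (by decide) ?_
  have h01 : (0 : ℝ) ≤ 0 ∧ (0 : ℝ) ≤ 1 := ⟨le_rfl, zero_le_one⟩
  have h11 : (0 : ℝ) ≤ 1 ∧ (1 : ℝ) ≤ 1 := ⟨zero_le_one, le_rfl⟩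
  rw [d_mass_eq w hw (t := 1) (by simp) h11, d_mass_eq w hw (t := 0) (by simp) h01,
    rcPartitionFunctionW_eq_sum_mul_one, d_mass_eq w hw (t := 0) (by simp) h01 (fun _ => (1 : ℝ)),
    rcPartitionFunctionW_eq_sum_mul_one, d_mass_eq w hw (t := 1) (by simp) h11 (fun _ => (1 : ℝ))]
  simp only [mul_one]
  rw [sum_mR_d_disc_t1, sum_mR_d_disc_t0, sum_mR_d_t0, sum_mR_d_t1]
  have key := bracketDisj_nonneg (q := q) (w s(0, 2)).2.1 (w s(0, 2)).2.2 (w s(0, 3)).2.1 (w s(0, 3)).2.2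
    (w s(1, 2)).2.1 (w s(1, 2)).2.2 (w s(1, 3)).2.1 (w s(1, 3)).2.2 hq0.le hq1
  linarith

/-- **`K₄` is Potts–Rayleigh, adjacent pairs**: for a loop-free weight vector on `Fin 4` and `0 < q ≤ 1`,
`φ(J_{01} ∩ J_{02}) ≤ φ(J_{01})·φ(J_{02})`. [cite: Wagner2006, Ex. 5.2] [cite: Grimmett2006, §3.9 eq. (3.94) (p. 63)] -/
theorem nc_norm_a (w : Sym2 (Fin 4) → unitInterval) (hw : ∀ x : Fin 4, (w s(x, x) : ℝ) = 0) {q : ℝ} (hq0 : 0 < q)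
    (hq1 : q ≤ 1) :
    (rcMeasureW w q ∅).real ({ω | s((0 : Fin 4), 1) ∈ ω} ∩ {ω | s((0 : Fin 4), 2) ∈ ω}) ≤
      (rcMeasureW w q ∅).real {ω | s((0 : Fin 4), 1) ∈ ω} * (rcMeasureW w q ∅).real {ω | s((0 : Fin 4), 2) ∈ ω} := by
  refine nc_of_bracket w hq0 hq1 _ (by decide) ?_
  have h01 : (0 : ℝ) ≤ 0 ∧ (0 : ℝ) ≤ 1 := ⟨le_rfl, zero_le_one⟩
  have h11 : (0 : ℝ) ≤ 1 ∧ (1 : ℝ) ≤ 1 := ⟨zero_le_one, le_rfl⟩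
  rw [a_mass_eq w hw (t := 1) (by simp) h11, a_mass_eq w hw (t := 0) (by simp) h01,
    rcPartitionFunctionW_eq_sum_mul_one, a_mass_eq w hw (t := 0) (by simp) h01 (fun _ => (1 : ℝ)),
    rcPartitionFunctionW_eq_sum_mul_one, a_mass_eq w hw (t := 1) (by simp) h11 (fun _ => (1 : ℝ))]
  simp only [mul_one]
  rw [sum_mR_a_disc_t1, sum_mR_a_disc_t0, sum_mR_a_t0, sum_mR_a_t1]
  have key := bracketAdj_nonneg (q := q) (w s(0, 3)).2.1 (w s(0, 3)).2.2 (w s(1, 2)).2.1 (w s(1, 2)).2.2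
    (w s(1, 3)).2.1 (w s(1, 3)).2.2 (w s(2, 3)).2.1 (w s(2, 3)).2.2 hq0.le hq1
  linarith

end FK

end Summit.CriticalPhenomena.PercolationContinuityZ3.Theorems

end
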